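import Summits.BirchSwinnertonDyer.BirchSwinnertonDyer.Theorems.ByReductionTypeAtTwoSupersingularFlatKerGCount
import HarnessLib

/-!
# The archimedean-factor reading of COUNT♭@2 is REFUTED: no count `#ker g♭ · #E(ℚ)_p = p^{e + ord_p ∏ c_ℓ} ·
# #(Sel♭_∞)_γ` with `e ≥ 1` can hold — a Negative lemma answering GEN 10's disprover-wanted (4)

Seat `bsd-2adic-ss-1` GEN 11, crux `SupersingularRankZeroAtTwo` (item stmt-BirchSwinnertonDyer-19097, route
`ByReductionTypeAtTwo`, rung K4), line `signed_halves_two` v9, stub (5) `stub_pmFlatDataV9`, conjunct COUNT♭@2.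
Part 4 of the GEN 11 series (part 1 `…FlatKerGCount.lean`: `#ker g♭ ∣ p^{ord_p ∏ c_ℓ}`).

GEN 10 asked (open (4), «disprover-wanted»): on a `Δ > 0` class, where `#H¹(ℝ, E[2^∞]) = 2`, is that `2`
absorbed in COUNT♭@2, or should the count at `p = 2` carry an extra archimedean factor — Kato's «(14.9.3)
exact up to `×2` in the case `p = 2`»? PRINT says absorbed (Greenberg, LNM 1716 p. 107: «For archimedean `v`,
one easily verifies that `𝒫_E^{(v)}(F) ≅ 𝒫_E^{(v)}(F_∞)^Γ`»; p. 106; p. 113). This file adds the KERNEL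
verdict on the alternative: since `#ker g♭ ∣ p^{ord_p ∏ c_ℓ}` (part 1) and `#(Sel♭_∞)_γ ≥ 1`, the identity
`#ker g♭ · 1 = p^{e + ord_p ∏ c_ℓ} · #(Sel♭_∞)_γ` is FALSE for every `e ≥ 1`, for EVERY datum satisfying the
Honda clauses (no Cassels, no Poitou–Tate, no hypothesis on `Δ`). So a «real-place-corrected» Lemma 5.5 at
`2` is not a weaker variant of COUNT♭@2 but a refuted one; the displayed COUNT♭@2 is the only candidate, and
part 2 (`…FlatCountUnpacked.lean`) says what it asserts.

WHAT IS PROVED (namespace `…Theorems.SSFlatEC`; setting of part 1: `W/ℚ` elliptic, globally minimal, ANY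
prime `p`, a CYCLOTOMIC `ℤ_p`-extension, the place `v ∋ p`, a local `g` restricting to a generator, local
points `c` with the Honda clauses, no `p`-torsion in `E(ℚ_∞·ℚ_p)`, `#E[p^∞]^{Γ_ℚ} = 1`):
* `not_flatCount_extraFactor` — for every `e ≥ 1` and every `γ`, with `(Sel♭_∞)_γ` finite:
  `¬ (#ker g♭ · #E[p^∞]^{Γ_ℚ} = p^{e + ord_p ∏ c_ℓ} · #(Sel♭_∞)_γ)`;
* `not_flatCountTwo_archimedeanFactor` — the `p = 2`, `e = 1` instance on the v9 data (`GoodSS W 2`; Lemma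
  2.3 at `2` and `#E(ℚ)[2^∞] = 1` discharged as in `SSFlatRoad.flatEulerChar_two`).
HONEST FRAMING: a negative lemma about a MIS-reading, not about the line's stub (which stays as displayed and
is true in print); nothing about any curve is asserted; no census cell moves; BSD is not proved by any of this.

References: [GreenbergLNM1716] §4 pp. 104–107, appendix p. 113; [Kato2004] (14.9.3) p. 279;
[Sprung2024] §5.2 Lemma 5.5 (p. 40).
-/

set_option autoImplicit false
-- the Theorems namespace of this sub repeats the summit name by design (D-0017 nested layout)
set_option linter.dupNamespace false

noncomputable section

open scoped Classical NumberField

open NumberField IsDedekindDomain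

universe u

namespace Summit.BirchSwinnertonDyer.BirchSwinnertonDyer.Theorems.SSFlatEC

open Literature.NumberTheory.EllipticCurves Literature.NumberTheory.GaloisRepresentations
  WeierstrassCurve ZpExtension Literature.NumberTheory.EllipticCurves.Kobayashi2003
  Literature.NumberTheory.EllipticCurves.Sprung2017 Literature.NumberTheory.EllipticCurves.Sprung2012
  Literature.NumberTheory.EllipticCurves.Sprung2024 Literature.NumberTheory.EllipticCurves.IwasawaDual
  Literature.NumberTheory.EllipticCurves.IwasawaAlgebra
  Literature.NumberTheory.EllipticCurves.Rank1Residual Summit.BirchSwinnertonDyer.Rank1Residual.X5.O1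

variable (W : WeierstrassCurve ℚ) [W.IsElliptic] [W.IsGloballyMinimal] (p : ℕ) [Fact p.Prime]
  {v : HeightOneSpectrum (𝓞 ℚ)}

omit [Fact p.Prime] in
/-- Arithmetic: if `k ∣ p^t`, `1 < p`, `1 ≤ e` and `1 ≤ s` then `k · 1 ≠ p^{e+t} · s`. [folklore] -/
theorem mul_one_ne_pow_add_mul {k t s e : ℕ} (hp : 1 < p) (hk : k ∣ p ^ t) (he : 1 ≤ e) (hs : 0 < s) :
    k * 1 ≠ p ^ (e + t) * s := by
  intro h
  have hp0 : 0 < p := lt_trans Nat.zero_lt_one hp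
  have hle : k ≤ p ^ t := Nat.le_of_dvd (pow_pos hp0 t) hk
  have hlt : p ^ t < p ^ (e + t) := Nat.pow_lt_pow_right hp (by omega)
  have hge : p ^ (e + t) ≤ p ^ (e + t) * s := Nat.le_mul_of_pos_right _ hs
  omega

/-- **No extra factor in COUNT♭** (any `p`): under the Honda clauses (cyclotomic `κ`, `v ∋ p`, `g`, `c`, Lemma
2.3) and `#E[p^∞]^{Γ_ℚ} = 1`, for every `e ≥ 1` and every `γ` with `(Sel♭_∞)_γ` finite, the «corrected» count
`#ker g♭ · #E[p^∞]^{Γ_ℚ} = p^{e + ord_p ∏ c_ℓ} · #(Sel♭_∞)_γ` is FALSE — because `#ker g♭ ∣ p^{ord_p ∏ c_ℓ}`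
(part 1) and `#(Sel♭_∞)_γ ≥ 1`. At `p = 2`, `e = 1` this is the archimedean-factor reading of Sprung 2024
Lemma 5.5 / Kato (14.9.3) «×2»: refuted, in agreement with Greenberg LNM 1716 p. 107 («For archimedean `v`
… `𝒫_E^{(v)}(F) ≅ 𝒫_E^{(v)}(F_∞)^Γ`»). [cite: GreenbergLNM1716, §4 pp. 104–107] [cite: Sprung2024, §5.2 Lemma 5.5 (p. 40)] -/
theorem not_flatCount_extraFactor {κ : ZpExtension ℚ p} (hκ : κ.IsCyclotomic)
    (γ : Field.absoluteGaloisGroup ℚ) (hpv : (p : 𝓞 ℚ) ∈ v.asIdeal)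
    (hnt : ∀ P ∈ localTowerPointsOfEmb κ (closureEmb (K := ℚ) (v.adicCompletion ℚ)) W, p • P = 0 → P = 0)
    (hap : (p : ℤ) ∣ W.frobeniusTrace p) {g : Field.absoluteGaloisGroup (v.adicCompletion ℚ)}
    (hg : κ.IsTopGenerator (resGalOfEmb (closureEmb (K := ℚ) (v.adicCompletion ℚ)) g))
    {c : ℕ → localPoints W (v.adicCompletion ℚ)}
    (hc : ∀ n, c n ∈ localLayerPointsOfEmb κ (closureEmb (K := ℚ) (v.adicCompletion ℚ)) W n)
    (hTr : ∀ n, 1 ≤ n → localTraceOfEmb κ (closureEmb (K := ℚ) (v.adicCompletion ℚ)) W n (n + 1)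
      (c (n + 1)) = W.frobeniusTrace p • c n - c (n - 1))
    (hinj : ∀ z₀ : localLayerPointsOfEmb κ (closureEmb (K := ℚ) (v.adicCompletion ℚ)) W 0 →+ ℤ_[p],
      evalOn W (localLayerPointsOfEmb κ (closureEmb (K := ℚ) (v.adicCompletion ℚ)) W 0) z₀ (c 0) = 0 →
        z₀ = 0)
    (hsat : ∀ a : ℤ_[p],
      (∃ z₀ : localLayerPointsOfEmb κ (closureEmb (K := ℚ) (v.adicCompletion ℚ)) W 0 →+ ℤ_[p],
        evalOn W (localLayerPointsOfEmb κ (closureEmb (K := ℚ) (v.adicCompletion ℚ)) W 0) z₀ (c 0) =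
          p * a) →
      ∃ y : localLayerPointsOfEmb κ (closureEmb (K := ℚ) (v.adicCompletion ℚ)) W 0 →+ ℤ_[p],
        evalOn W (localLayerPointsOfEmb κ (closureEmb (K := ℚ) (v.adicCompletion ℚ)) W 0) y (c 0) = a)
    (htors : Nat.card (MulAction.fixedPoints (Field.absoluteGaloisGroup ℚ) (W.geomPrimaryTorsion p)) = 1)
    {e : ℕ} (he : 1 ≤ e)
    (hco : Finite (EndCoinvariants (conjSharpFlatSelmerInfty W κ (closureEmb (K := ℚ) (v.adicCompletion ℚ))
        (W.frobeniusTrace p) g c Chroma.flat γ - 1))) :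
    ¬ (Nat.card (↥((sharpFlatSelmerInfty W κ (closureEmb (K := ℚ) (v.adicCompletion ℚ))
            (W.frobeniusTrace p) g c Chroma.flat).comap (W.layerToInfty κ 0)) ⧸
          (W.selmerLayer κ 0).addSubgroupOf
            ((sharpFlatSelmerInfty W κ (closureEmb (K := ℚ) (v.adicCompletion ℚ))
              (W.frobeniusTrace p) g c Chroma.flat).comap (W.layerToInfty κ 0))) *
        Nat.card (MulAction.fixedPoints (Field.absoluteGaloisGroup ℚ) (W.geomPrimaryTorsion p)) =
      p ^ (e + padicValNat p W.tamagawaProduct) *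
        Nat.card (EndCoinvariants (conjSharpFlatSelmerInfty W κ
          (closureEmb (K := ℚ) (v.adicCompletion ℚ)) (W.frobeniusTrace p) g c Chroma.flat γ - 1))) := by
  have hdvd := natCard_flatKerG_dvd_pow_padicValNat_tamagawaProduct W p hκ hpv hnt hap hg hc hTr hinj hsat
  rw [htors]
  haveI := hco
  exact mul_one_ne_pow_add_mul p (Fact.out : p.Prime).one_lt hdvd he Nat.card_pos

/-- **The archimedean-factor reading of COUNT♭@2 is refuted on the v9 data.** For `W/ℚ` elliptic, globally
minimal, good SUPERSINGULAR at `2`, a cyclotomic `ℤ₂`-extension, the place `v ∋ 2`, `g`, `c` with the Honda₂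
clauses of `stub_pmFlatDataV9`, every `γ` with `(Sel♭_∞)_γ` finite:
`#ker g♭ · #E[2^∞]^{Γ_ℚ} ≠ 2^{1 + ord₂ ∏ c_ℓ} · #(Sel♭_∞)_γ`. (GEN 10 open (4): the `2 = #H¹(ℝ, E[2^∞])` of a
`Δ > 0` class does NOT enter Lemma 5.5 at `2`; Greenberg p. 107.) [cite: GreenbergLNM1716, §4 pp. 106–107 and appendix p. 113]
[cite: Kato2004, (14.9.3) p. 279] -/
theorem not_flatCountTwo_archimedeanFactor (W : WeierstrassCurve ℚ) [W.IsElliptic] [W.IsGloballyMinimal]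
    (hss : GoodSS W 2) {κ : ZpExtension ℚ 2} (hκ : κ.IsCyclotomic) (γ : Field.absoluteGaloisGroup ℚ)
    {v : HeightOneSpectrum (𝓞 ℚ)} (hv : (2 : 𝓞 ℚ) ∈ v.asIdeal)
    {g : Field.absoluteGaloisGroup (v.adicCompletion ℚ)}
    (hg : κ.IsTopGenerator (resGalOfEmb (closureEmb (K := ℚ) (v.adicCompletion ℚ)) g))
    {c : ℕ → localPoints W (v.adicCompletion ℚ)}
    (hc : ∀ n, c n ∈ localLayerPointsOfEmb κ (closureEmb (K := ℚ) (v.adicCompletion ℚ)) W n)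
    (hTr : ∀ n, 1 ≤ n → localTraceOfEmb κ (closureEmb (K := ℚ) (v.adicCompletion ℚ)) W n (n + 1)
      (c (n + 1)) = W.frobeniusTrace 2 • c n - c (n - 1))
    (hinj : ∀ z₀ : localLayerPointsOfEmb κ (closureEmb (K := ℚ) (v.adicCompletion ℚ)) W 0 →+ ℤ_[2],
      evalOn W (localLayerPointsOfEmb κ (closureEmb (K := ℚ) (v.adicCompletion ℚ)) W 0) z₀ (c 0) = 0 →
        z₀ = 0)
    (hsat : ∀ a : ℤ_[2],
      (∃ z₀ : localLayerPointsOfEmb κ (closureEmb (K := ℚ) (v.adicCompletion ℚ)) W 0 →+ ℤ_[2],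
        evalOn W (localLayerPointsOfEmb κ (closureEmb (K := ℚ) (v.adicCompletion ℚ)) W 0) z₀ (c 0) =
          2 * a) →
      ∃ y : localLayerPointsOfEmb κ (closureEmb (K := ℚ) (v.adicCompletion ℚ)) W 0 →+ ℤ_[2],
        evalOn W (localLayerPointsOfEmb κ (closureEmb (K := ℚ) (v.adicCompletion ℚ)) W 0) y (c 0) = a)
    (hco : Finite (EndCoinvariants (conjSharpFlatSelmerInfty W κ (closureEmb (K := ℚ) (v.adicCompletion ℚ))
        (W.frobeniusTrace 2) g c .flat γ - 1))) :
    Nat.card (↥((sharpFlatSelmerInfty W κ (closureEmb (K := ℚ) (v.adicCompletion ℚ))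
            (W.frobeniusTrace 2) g c .flat).comap (W.layerToInfty κ 0)) ⧸
          (W.selmerLayer κ 0).addSubgroupOf
            ((sharpFlatSelmerInfty W κ (closureEmb (K := ℚ) (v.adicCompletion ℚ))
              (W.frobeniusTrace 2) g c .flat).comap (W.layerToInfty κ 0))) *
        Nat.card (MulAction.fixedPoints (Field.absoluteGaloisGroup ℚ) (W.geomPrimaryTorsion 2)) ≠
      2 ^ (1 + padicValNat 2 W.tamagawaProduct) *
        Nat.card (EndCoinvariants (conjSharpFlatSelmerInfty W κ
          (closureEmb (K := ℚ) (v.adicCompletion ℚ)) (W.frobeniusTrace 2) g c .flat γ - 1)) := by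
  -- Lemma 2.3 at `2`
  have hnt : ∀ P ∈ localTowerPointsOfEmb κ (closureEmb (K := ℚ) (v.adicCompletion ℚ)) W, 2 • P = 0 → P = 0 :=
    fun P hP h2 ↦ eq_zero_of_mem_localTowerPointsOfEmb_of_two_nsmul W hss κ hv _ hP h2
  -- `#E[2^∞]^{Γ_ℚ} = 1`
  have htors : Nat.card (MulAction.fixedPoints (Field.absoluteGaloisGroup ℚ) (W.geomPrimaryTorsion 2)) = 1 := by
    refine W.natCard_fixedPoints_absoluteGaloisGroup_geomPrimaryTorsion_eq_one (p := 2) fun P hP ↦ ?_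
    have h := (irr_two_iff_forall_two_nsmul W).mp
      (Summit.BirchSwinnertonDyer.Rank1Residual.P2.irr_two_of_goodSS_two W hss) P
    apply h
    convert hP
  exact not_flatCount_extraFactor W 2 hκ γ (by exact_mod_cast hv) hnt hss.2 hg hc hTr hinj hsat htors
    le_rfl hco

end Summit.BirchSwinnertonDyer.BirchSwinnertonDyer.Theorems.SSFlatEC

end
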